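import Summits.BirchSwinnertonDyer.BirchSwinnertonDyer.Theorems.SchneiderFreeAdditiveX3GordCellThreeAnomalousPerPair
import Summits.BirchSwinnertonDyer.BirchSwinnertonDyer.Theorems.SchneiderFreeAdditiveX3AnomalousTwistNormalisedMember
import Summits.BirchSwinnertonDyer.BirchSwinnertonDyer.Theorems.ByReductionTypeAtTwoOrdEisensteinHalfShaIsogeny
import Summits.BirchSwinnertonDyer.Rank1Residual.Additive.SubGordThree
import Summits.BirchSwinnertonDyer.Rank1Residual.Additive.GordIsogenyInvariance
import HarnessLib

/-!
# Route `SchneiderFreeAdditiveX3` (K1 door) on the (G-ord, `e = 2`) cell AT `p = 3`, PER PAIR WITH NO PER-LATTICE HYPOTHESIS: the LOWER half of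
# BSD₃ for EVERY anomalous pair (the Keller–Yin-normalised member exists, FILE 16a; Cassels transports the half back), and hence for EVERY
# pair of the cell (NAT ∨ anomalous); with the twist-unit datum, `MissingPPartAt W 3` and Miller's `BSD(E, 3)` on the whole cell

Cell `bsd-schneider-ideate`, seat `bsd-schneider-door-c5` (prover, generation 32; assembly layer; `--supports` 19177).
PARTITION: board row B6 ∩ X3 ∩ sst-twist, `r = 1`, (G-ord, `e = 2`) half at `p = 3` — ALL 2 411 pairs (686 NAT + 1 725 ANOMALOUS) of
`Rank1Residual.partition`; types-the-object-of nothing; closes none of B6's cells (BSD NOT advanced).  bears_on: K1-door (19177 r3; FYI wing 20365).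
FILE 16b of the anomalous-twin port.

WHAT.
* §1 TRANSPORT: `classX3_subGordTwo_of_isIsogenous_three` (the cell predicates at `3` are `ℚ`-isogeny invariants: reducibility, `Addv` and `TypeG` —
  `Additive.subGordTwo_three_iff_typeG`, `TypeG.of_isIsogenous`, `Addv.of_isIsogenous_of_typeG`), `exists_anomalousModel_of_isIsogenous` (an anomalous
  good-ordinary twist model passes to every globally minimal member of the class: the models are isogenous through the double twist, Faltings for `a₃`).
* §2 **`missingLowerBoundAt_gordTwo_three_anomalous_class`** — LOWER half per pair for EVERY globally minimal `W` with `r_an = 1`, `ClassX3 W 3`,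
  `SubGordTwo W 3` and an anomalous twist model, NO normalisation hypothesis: FILE 16a's normalised member `W₁ ~ W`, FILE 15 §1 at `W₁`, Cassels'
  isogeny invariance of the lower half (`EisensteinShaCurrency.missingLowerBoundAt_of_isIsogenous`, kernel modulo `PrintedFacts`' conjuncts GZK,
  modularity, Cassels).
* §3 **`missingLowerBoundAt_gordTwo_three`** — THE WHOLE (G-ord, `e = 2`) CELL AT `p = 3`, NO PER-PAIR HYPOTHESIS: `MissingLowerBoundAt W 3` for EVERY
  globally minimal `W` with `r_an = 1`, `ClassX3 W 3`, `SubGordTwo W 3` (dichotomy NAT ∨ anomalous, generation 29: generation 27 on NAT, §2 on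
  anomalous); **`missingPPartAt_gordTwo_three_of_twistUnitAt`**, **`bsdp_gordTwo_three_of_twistUnitAt`** — with generation 29's cell-wide UPPER
  half from the TU datum: `MissingPPartAt W 3` and Miller's `BSD(E, 3)` for every such pair carrying `Upper.TwistUnitFieldOffSliverAt W 3`.

INPUT LEDGER PER PAIR, (G-ord, `e = 2`), `p = 3`, ALL 2 411 pairs: PUBLISHED facts by name (`PrintedFacts`, Hsieh A, LZZ, Castella–Hsieh signed, CGLS
Thm. 2.1.2, Props. 1.2.5/14, Cor. 1.2.6 ×2, Thm. 1.2.2-as-[BR3], Greenberg 2016 ×2, Greenberg 2006 ×2 (+2 tree theorems), Bleher et al. 3.3.1, de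
Shalit II.6.4, Hida Thm. I) ∪ {[DIV.dvd] (PREPRINT), [AN3] and its hna-free form (PREPRINT sentences, PUB-composed at `p = 3`, audit pending),
[RH], [PWL-θ] (bsd-eis typed)} ∪ {the pair's TU certificate — upper half only}.  NO per-lattice, NO per-curve hypothesis beyond the cell predicates.

HONEST FRAMING: THEOREMS ONLY; pure composition of tree theorems, CONDITIONAL on the displayed hypotheses; [DIV.dvd]/[AN3]/its hna-free form
are unrefereed PREPRINT sentences; nothing is closed by me; BSD is proved for no curve — per pair BSD₃ MODULO {published theorems} ∪ {[DIV.dvd], the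
counts, [RH], [PWL-θ]} ∪ {TU}; «closes rung: none».  References: [KellerYin2024b] Thm. 3.3.6, Prop. 3.4.4, Thm. 3.5.1, Assumption 2.0.3;
[KellerYin2024] Thms. 1.2.2, 1.4.1, 2.2.2, 2.2.3, Prop. 1.2.5, 1.3.1; [CastellaGrossiLeeSkinner2022]; [MilneADT2006] I.7.3 (Cassels); [Miller2011LMS]
Def. 1.1; [Ribet1976] Prop. 2.1; this seat p726857 (F15), p727365 (F16a), p684792 (gen 27), p698824 (gen 29).
-/

set_option autoImplicit false
-- `Summit.<P>.<Sub>` repeats `BirchSwinnertonDyer` by the tree's layout convention (D-0017)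
set_option linter.dupNamespace false

noncomputable section

open scoped Classical NumberField

open Field NumberField IsDedekindDomain WeierstrassCurve
  Literature.NumberTheory.EllipticCurves Literature.NumberTheory.EllipticCurves.GreenbergSelmer
  Literature.NumberTheory.GaloisRepresentations Literature.NumberTheory.GaloisCohomology
  Literature.NumberTheory.EllipticCurves.ModularForms Literature.NumberTheory.EllipticCurves.Rank1Residual
  Literature.NumberTheory.EllipticCurves.Rank1Residual.Typed
  Literature.NumberTheory.EllipticCurves.KellerYin2024 Literature.NumberTheory.EllipticCurves.CaiShuTian2014
  Literature.NumberTheory.IwasawaTheory Literature.NumberTheory.IwasawaTheory.Greenberg2016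
  Literature.NumberTheory.IwasawaTheory.Greenberg2006
  Literature.NumberTheory.EllipticCurves.Rubin1991 Literature.NumberTheory.EllipticCurves.DeShalit1987
  Literature.NumberTheory.EllipticCurves.Hida2010MuInvariant Literature.NumberTheory.EllipticCurves.BCGKPST2020
  Summit.BirchSwinnertonDyer.Rank1Residual Summit.BirchSwinnertonDyer.Rank1Residual.X11b
  Summit.BirchSwinnertonDyer.Rank1Residual.X11b.AcSelmer Summit.BirchSwinnertonDyer.Rank1Residual.X11b.Halves
  Summit.BirchSwinnertonDyer.Rank1Residual.Additive Summit.BirchSwinnertonDyer.Rank1Residual.GaloisImage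
  Summit.BirchSwinnertonDyer.BirchSwinnertonDyer.Theorems.SchneiderFree
  Summit.BirchSwinnertonDyer.BirchSwinnertonDyer.Theorems.SchneiderFree.Upper
  Summit.BirchSwinnertonDyer.BirchSwinnertonDyer.Theorems.SchneiderFree.KYRead
  Summit.BirchSwinnertonDyer.BirchSwinnertonDyer.Theses.SchneiderFreeAdditiveX3
  Summit.BirchSwinnertonDyer.BirchSwinnertonDyer.Theorems.EisensteinShaCurrency
  Summit.BirchSwinnertonDyer.BirchSwinnertonDyer.Theorems.SchneiderFreeAdditiveX3.KYBranchThreePerPair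
  Summit.BirchSwinnertonDyer.BirchSwinnertonDyer.Theorems.SchneiderFreeAdditiveX3.KYBranchThreeAnomalousPerPair
  Summit.BirchSwinnertonDyer.BirchSwinnertonDyer.Theorems.SchneiderFreeAdditiveX3.AnomalousTwistNormalisedMember
  Summit.BirchSwinnertonDyer.BirchSwinnertonDyer.Theorems.SchneiderFreeAdditiveX3.UpperThreeAnomalousOfPartnerClass
open Literature.NumberTheory.EllipticCurves.CastellaGrossiLeeSkinner2022
  (prop14_residualCharacterSelmer_finite thm212_exists_isKatzLFunction prop125_characterGrSelmerDual_torsion_muZero_dim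
    cor126_residualCharacter_globalLift cor126_residualCharacter_localSurjective)
open Literature.NumberTheory.EllipticCurves.KellerYin2024 (thm122_rubinHida_residualPair_unrSelmer prop125_residualPair_unrSelmer_imprimitive
  thm351_anacong_branch_three_allTwists)

namespace Summit.BirchSwinnertonDyer.BirchSwinnertonDyer.Theorems.SchneiderFreeAdditiveX3.KYBranchThreeAnomalousClass

/-! ### §1 Transport along a `ℚ`-isogeny: the cell predicates at `3` and the anomalous twist model -/

/-- **The (G-ord, `e = 2`) cell at `3` is a union of `ℚ`-isogeny classes.**  `ClassX3 W 3` (reducible `W[3]`, additive `3`) and `SubGordTwo W 3`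
(`= TypeG W 3` on the additive locus at `3`, `Additive.subGordTwo_three_iff_typeG`) pass to every globally minimal `W₁ ~ W`: reducibility
(`not_hasIrreducibleModPGaloisRep_of_isIsogenous`), type (G) (`TypeG.of_isIsogenous`), additivity on the (G)-cell (`Addv.of_isIsogenous_of_typeG`).
[cite: SilvermanAEC2009, Cor. VII.7.2, VII.5.5] [cite: Delbourgo1998, §1.5 (G)] [cite: Kraus1990, Thm. 1 (the I₀* row at p = 3)] -/
theorem classX3_subGordTwo_of_isIsogenous_three {W W₁ : WeierstrassCurve ℚ} [W.IsElliptic] [W.IsGloballyMinimal] [W₁.IsElliptic]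
    [W₁.IsGloballyMinimal] (hX : ClassX3 W 3) (hSG : Additive.SubGordTwo W 3) (hiso : IsIsogenous W W₁) :
    ClassX3 W₁ 3 ∧ Additive.SubGordTwo W₁ 3 := by
  have hred₁ : Red W₁ 3 := not_hasIrreducibleModPGaloisRep_of_isIsogenous hiso hX.1
  have hG : Additive.TypeG W 3 := (Additive.subGordTwo_three_iff_typeG W hX.2).mp hSG
  have hadd₁ : Addv W₁ 3 := Additive.Addv.of_isIsogenous_of_typeG hX.2 hG hiso
  exact ⟨⟨hred₁, hadd₁⟩, (Additive.subGordTwo_three_iff_typeG W₁ hadd₁).mpr (hG.of_isIsogenous hiso)⟩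

/-- **An anomalous good-ordinary twist model passes along a `ℚ`-isogeny within the cell.**  If `W = C • V^{(3*)}` with `V` globally minimal good
ordinary anomalous at `3`, and `W₁ ~ W` is globally minimal on the cell, then `W₁ = C₁ • V₁^{(3*)}` with `V₁` globally minimal good ordinary
ANOMALOUS: a model exists (`exists_goodOrd_partner_of_subGordTwo_odd`), `V^{(3*)} ~ W ~ W₁ ~ V₁^{(3*)}` so `V ~ V₁` (double twist), and
`a₃(V₁) = a₃(V)` (Faltings). [cite: SilvermanAEC2009, X.5 Cor. 5.4, VII.7.2] [cite: Faltings1983Endlichkeit, §5 Korollar 2] -/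
theorem exists_anomalousModel_of_isIsogenous {W W₁ V : WeierstrassCurve ℚ} [W.IsElliptic] [W₁.IsElliptic] [W₁.IsGloballyMinimal]
    [V.IsElliptic] [V.IsGloballyMinimal] (hV : GoodOrd V 3) (ha : (3 : ℤ) ∣ V.frobeniusTrace 3 - 1)
    (CV : VariableChange ℚ) (hCV : CV • V.quadraticTwist ((-1 : ℚ) ^ (3 / 2) * (3 : ℕ)) = W)
    (hiso : IsIsogenous W W₁) (hX₁ : ClassX3 W₁ 3) (hSG₁ : Additive.SubGordTwo W₁ 3) :
    ∃ (V₁ : WeierstrassCurve ℚ) (_ : V₁.IsElliptic) (_ : V₁.IsGloballyMinimal) (C₁ : VariableChange ℚ),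
      GoodOrd V₁ 3 ∧ (3 : ℤ) ∣ V₁.frobeniusTrace 3 - 1 ∧ C₁ • V₁.quadraticTwist ((-1 : ℚ) ^ (3 / 2) * (3 : ℕ)) = W₁ := by
  have hp2 : (3 : ℕ) ≠ 2 := by norm_num
  obtain ⟨V₁, hE₁, hmin₁, C₁, hC₁, hord₁, -⟩ := exists_goodOrd_partner_of_subGordTwo_odd hp2 W₁ hX₁ hSG₁
  have hd : ((-1 : ℚ) ^ (3 / 2) * (3 : ℕ) : ℚ) ≠ 0 := by norm_num
  -- `V^{(3*)} ~ V₁^{(3*)}` through `W ~ W₁`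
  have h1 : IsIsogenous (V.quadraticTwist ((-1 : ℚ) ^ (3 / 2) * (3 : ℕ))) (V₁.quadraticTwist ((-1 : ℚ) ^ (3 / 2) * (3 : ℕ))) := by
    have hW : IsIsogenous (V.quadraticTwist ((-1 : ℚ) ^ (3 / 2) * (3 : ℕ))) W := by rw [← hCV]; exact isIsogenous_smul _ CV
    have hW₁ : IsIsogenous W₁ (V₁.quadraticTwist ((-1 : ℚ) ^ (3 / 2) * (3 : ℕ))) := by rw [← hC₁]; exact isIsogenous_of_smul _ C₁
    exact (hW.trans' hiso).trans' hW₁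
  -- double twist: `V ~ V₁`
  obtain ⟨D, hD⟩ := exists_quadraticTwist_quadraticTwist_eq_smul V hd
  obtain ⟨D₁, hD₁⟩ := exists_quadraticTwist_quadraticTwist_eq_smul V₁ hd
  have h2 := h1.quadraticTwist hd
  rw [hD, hD₁] at h2
  have hVV₁ : V.IsIsogenous V₁ := ((isIsogenous_smul V D).trans' h2).trans' (isIsogenous_of_smul V₁ D₁)
  refine ⟨V₁, hE₁, hmin₁, C₁, hord₁, ?_, hC₁⟩
  rw [← frobeniusTrace_eq_of_isIsogenous hVV₁ 3 hV.1 hord₁.1]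
  exact ha

/-! ### §2 The LOWER half per pair for EVERY anomalous pair — no normalisation hypothesis -/

/-- **LOWER half per pair on the (G-ord, `e = 2`) cell AT `p = 3` for EVERY pair with an anomalous twist model — NO per-lattice hypothesis** ⇐
`PrintedFacts` ∧ Hsieh 2014 Thm. A ∧ Liu–Zhang–Zhang 2018 ∧ Castella–Hsieh signed ∧ [DIV.dvd] (PREPRINT) ∧ the typed hna-free analytic count ∧ CGLS
Thm. 2.1.2 ∧ [RH] ∧ [PWL-θ] ∧ the published facts.  For every globally minimal `W/ℚ` with `r_an = 1`, `ClassX3 W 3`, `SubGordTwo W 3` and an anomalous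
good-ordinary twist model: `MissingLowerBoundAt W 3`.  Proof: the Keller–Yin-normalised member `W₁ ~ W` EXISTS (FILE 16a,
`AnomalousTwistNormalisedMember.exists_isIsogenous_normalised_of_anomalousTwist`); `W₁` lies on the cell with `r_an = 1` and an anomalous model (§1,
`analyticRank_eq_of_isIsogenous'`); FILE 15 §1 gives the half for `W₁`; Cassels' isogeny invariance of the BSD quotient (`PrintedFacts` conjunct 6) with
GZK (conjunct 3: `Ш(W₁)` finite) and modularity (conjunct 4: `L′(W₁,1) ≠ 0` as `r_an = 1`) transports it to `W`
(`EisensteinShaCurrency.missingLowerBoundAt_of_isIsogenous`).  CONDITIONAL on the displayed named statements; closes no item; BSD not advanced.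
[claim: KellerYin2024PotOrd, status: under-review]
[cite: KellerYin2024b, Assumption 2.0.3, Thm. 3.3.6, Prop. 3.4.4, Thm. 3.5.1 (arXiv:2410.23241) (preprint; the Kolyvagin divisibility a hypothesis)]
[cite: MilneADT2006, Thm. I.7.3 (Cassels)] [cite: Ribet1976, Prop. 2.1] [cite: KellerYin2024, Thms. 1.2.2, 2.2.2, 2.2.3, Prop. 1.3.1 (arXiv:2402.12781v2)] -/
theorem missingLowerBoundAt_gordTwo_three_anomalous_class (hF : PrintedFacts)
    (hA : Hsieh2014.thmA_exists_isHsiehLFunction_unrPeriod_anyLevel)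
    (hL : LiuZhangZhang2018.thm151_thm153_modularCurve_heegnerVector_additive)
    (hCHσ : castellaHsieh2018_exists_isBranchBDPLFunction_signed)
    (hDVD : thm336_dvd_branch_OPEN) (hAN : thm351_anacong_branch_three_allTwists) (h212 : thm212_exists_isKatzLFunction)
    (hRH : thm122_rubinHida_residualPair_unrSelmer) (hPWL : prop125_residualPair_unrSelmer_imprimitive)
    (h331 : thm331_rubin_exists_katzMeasure₂_pseudoIso_span_eq) (h411 : prop411_selmer_isAlmostDivisible)
    (hFE : thmII64_katzMeasure₂_functionalEquation) (hO1 : thmI_mu_katzBranch_reflect_eq_zero)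
    (h263 : prop263_sur_of_crk) (h41 : prop41_globalEulerPoincareCorank) (h32 : prop32_cohomology_isCofinitelyGenerated) :
    ∀ (W : WeierstrassCurve ℚ) [W.IsElliptic] [W.IsGloballyMinimal],
      W.analyticRank = 1 → ClassX3 W 3 → Additive.SubGordTwo W 3 →
      ∀ (V : WeierstrassCurve ℚ) [V.IsElliptic] [V.IsGloballyMinimal] (CV : VariableChange ℚ),
        GoodOrd V 3 → (3 : ℤ) ∣ V.frobeniusTrace 3 - 1 → CV • V.quadraticTwist ((-1 : ℚ) ^ (3 / 2) * (3 : ℕ)) = W →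
      MissingLowerBoundAt W 3 := by
  intro W _ _ hr hX hG V _ _ CV hV ha hCV
  have hGZK := hF.2.2.1
  have hmod := hF.2.2.2.1
  have hCas := hF.2.2.2.2.2.1
  -- the Keller–Yin-normalised member of the class
  obtain ⟨W₁, _, _, hiso, hnorm₁⟩ :=
    AnomalousTwistNormalisedMember.exists_isIsogenous_normalised_of_anomalousTwist (p := 3) rfl hV ha CV hCV
  obtain ⟨hX₁, hG₁⟩ := classX3_subGordTwo_of_isIsogenous_three hX hG hiso
  have hr₁ : W₁.analyticRank = 1 := (analyticRank_eq_of_isIsogenous' hiso).symm.trans hr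
  obtain ⟨V₁, _, _, C₁, hV₁, ha₁, hC₁⟩ := exists_anomalousModel_of_isIsogenous hV ha CV hCV hiso hX₁ hG₁
  -- the half for `W₁` (FILE 15) and its transport (Cassels)
  have h₁ := KYBranchThreeAnomalousPerPair.missingLowerBoundAt_gordTwo_three_anomalous hF hA hL hCHσ hDVD hAN h212 hRH hPWL h331 h411 hFE
    hO1 h263 h41 h32 W₁ hr₁ hX₁ hG₁ V₁ C₁ hV₁ ha₁ hC₁ hnorm₁
  have hfin₁ : Finite W₁.sha := (hGZK W₁ (le_of_eq hr₁)).2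
  have hlead₁ : W₁.leadingLCoeff ≠ 0 := W₁.leadingLCoeff_ne_zero_holds (hmod W₁)
  exact EisensteinShaCurrency.missingLowerBoundAt_of_isIsogenous hCas hiso hfin₁ hlead₁ h₁

/-! ### §3 THE WHOLE (G-ord, `e = 2`) CELL AT `p = 3`: the LOWER half with no per-pair hypothesis; BOTH halves and `BSD(E, 3)` with the TU datum -/

/-- **THE LOWER HALF OF BSD₃ PER PAIR ON THE WHOLE (G-ord, `e = 2`) CELL AT `p = 3` — NO per-pair hypothesis beyond the cell predicates.**  For EVERY
globally minimal `W/ℚ` with `r_an = 1`, `ClassX3 W 3`, `SubGordTwo W 3`: `MissingLowerBoundAt W 3` (`ord₃ #Ш(E)_an ≤ ord₃ #Ш(E)`) ⇐ `PrintedFacts` ∧ Hsieh A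
∧ LZZ ∧ Castella–Hsieh signed ∧ [DIV.dvd] ∧ BOTH typed analytic counts ∧ [BR3] ∧ CGLS Thm. 2.1.2, Props. 1.2.5, 14, Cor. 1.2.6 ×2 ∧ [RH] ∧ [PWL-θ] ∧
Greenberg 2016 ×2, 2006 ×2 (+ Prop. 4.2 / §5 A tree theorems) ∧ Bleher et al. ∧ de Shalit ∧ Hida.  By the dichotomy NAT ∨ anomalous
(`forall_twist_not_anomalous_or_exists_anomalous_twist`): generation 27's `KYBranchThreePerPair.missingLowerBoundAt_gordTwo_three_…_of_forall_twist` on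
the 686 NAT pairs, §2 on the 1 725 anomalous ones.  CONDITIONAL on the displayed named statements; closes no item; BSD not advanced.
[claim: KellerYin2024PotOrd, status: under-review]
[cite: KellerYin2024b, Thm. 3.3.6, Prop. 3.4.4, Thm. 3.5.1 (arXiv:2410.23241 pp. 19–20) (preprint; the Kolyvagin divisibility a hypothesis)]
[cite: CastellaGrossiLeeSkinner2022, Thms. 1.2.2, 2.1.2, 2.2.2, Props. 1.2.5, 14, Cor. 1.2.6] [cite: KellerYin2024, Thms. 1.2.2, 2.2.2, 2.2.3 (arXiv:2402.12781v2)]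
[cite: MilneADT2006, Thm. I.7.3] [cite: JetchevSkinnerWan2017, §7.4.1 (arXiv:1512.06894 p. 30)] [cite: FriedbergHoffstein1995, Thm. B] -/
theorem missingLowerBoundAt_gordTwo_three (hF : PrintedFacts)
    (hA : Hsieh2014.thmA_exists_isHsiehLFunction_unrPeriod_anyLevel)
    (hL : LiuZhangZhang2018.thm151_thm153_modularCurve_heegnerVector_additive)
    (hCHσ : castellaHsieh2018_exists_isBranchBDPLFunction_signed)
    (hDVD : thm336_dvd_branch_OPEN) (hAN3 : thm351_anacong_branch_three) (hAN : thm351_anacong_branch_three_allTwists)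
    (hBR : thm122_charLambda_pair_three) (h212 : thm212_exists_isKatzLFunction)
    (hprop125 : prop125_characterGrSelmerDual_torsion_muZero_dim) (hfact : prop14_residualCharacterSelmer_finite)
    (hlift : cor126_residualCharacter_globalLift) (hlocal : cor126_residualCharacter_localSurjective)
    (hRH : thm122_rubinHida_residualPair_unrSelmer) (hPWL : prop125_residualPair_unrSelmer_imprimitive)
    (h331 : thm331_rubin_exists_katzMeasure₂_pseudoIso_span_eq) (h411 : prop411_selmer_isAlmostDivisible)
    (hFE : thmII64_katzMeasure₂_functionalEquation) (hO1 : thmI_mu_katzBranch_reflect_eq_zero)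
    (h263 : prop263_sur_of_crk) (h41 : prop41_globalEulerPoincareCorank) (h32 : prop32_cohomology_isCofinitelyGenerated) :
    ∀ (W : WeierstrassCurve ℚ) [W.IsElliptic] [W.IsGloballyMinimal],
      W.analyticRank = 1 → ClassX3 W 3 → Additive.SubGordTwo W 3 → MissingLowerBoundAt W 3 := by
  intro W _ _ hr hX hG
  rcases forall_twist_not_anomalous_or_exists_anomalous_twist W hX hG with hNAT | ⟨V, _, _, C, hV, hC, ha⟩
  · exact KYBranchThreePerPair.missingLowerBoundAt_gordTwo_three_of_printedFacts_of_print_of_forall_twist hF hA hL hCHσ hDVD hAN3 hBR h212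
      hprop125 hfact hlift hlocal h411 h263 h41 Greenberg2006.prop42_localEulerPoincareCorank_holds
      Greenberg2006.sec5A_localH2_subsingleton_of_LOC1_holds h32 W hr hX hG hNAT
  · have hC' : C • V.quadraticTwist ((-1 : ℚ) ^ (3 / 2) * (3 : ℕ)) = W := by
      rw [show ((-1 : ℚ) ^ (3 / 2) * (3 : ℕ) : ℚ) = -3 by norm_num]; exact hC
    exact missingLowerBoundAt_gordTwo_three_anomalous_class hF hA hL hCHσ hDVD hAN h212 hRH hPWL h331 h411 hFE hO1 h263 h41 h32 W hr hX hG V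
      C hV ha hC'

/-- **BOTH halves per pair on the whole (G-ord, `e = 2`) cell AT `p = 3` from the TU datum: `MissingPPartAt W 3` (`ord₃ #Ш(E)_an = ord₃ #Ш(E)`)** —
§3's lower half and generation 29's cell-wide upper half (`UpperThreeAnomalousOfPartnerClass.missingUpperBoundAt_gordTwo_three_…`, ⟸ PUB ∪ {[DIV.dvd],
CGLS Prop. 14, [RH], [PWL-θ]} ∪ {TU}).  On the census (2 411 (G-ord) pairs at `p = 3`) TU is certified on every pair (generation 21); class-wide it is
wing r2 (OPEN).  CONDITIONAL; closes no item; BSD not advanced beyond this typed reduction. [claim: KellerYin2024PotOrd, status: under-review]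
[cite: Miller2011LMS, Def. 1.1] [cite: KellerYin2024b, Thm. 3.3.6 and Prop. 3.4.4 (arXiv:2410.23241 p. 19) (preprint; hypothesis)]
[cite: CastellaGrossiLeeSkinner2022, Thms. 1.2.2, 2.1.2, 2.2.2, Prop. 14] -/
theorem missingPPartAt_gordTwo_three_of_twistUnitAt (hF : PrintedFacts)
    (hA : Hsieh2014.thmA_exists_isHsiehLFunction_unrPeriod_anyLevel)
    (hL : LiuZhangZhang2018.thm151_thm153_modularCurve_heegnerVector_additive)
    (hCHσ : castellaHsieh2018_exists_isBranchBDPLFunction_signed)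
    (hDVD : thm336_dvd_branch_OPEN) (hAN3 : thm351_anacong_branch_three) (hAN : thm351_anacong_branch_three_allTwists)
    (hBR : thm122_charLambda_pair_three) (h212 : thm212_exists_isKatzLFunction)
    (hprop125 : prop125_characterGrSelmerDual_torsion_muZero_dim) (hfact : prop14_residualCharacterSelmer_finite)
    (hlift : cor126_residualCharacter_globalLift) (hlocal : cor126_residualCharacter_localSurjective)
    (hRH : thm122_rubinHida_residualPair_unrSelmer) (hPWL : prop125_residualPair_unrSelmer_imprimitive)
    (h331 : thm331_rubin_exists_katzMeasure₂_pseudoIso_span_eq) (h411 : prop411_selmer_isAlmostDivisible)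
    (hFE : thmII64_katzMeasure₂_functionalEquation) (hO1 : thmI_mu_katzBranch_reflect_eq_zero)
    (h263 : prop263_sur_of_crk) (h41 : prop41_globalEulerPoincareCorank) (h32 : prop32_cohomology_isCofinitelyGenerated) :
    ∀ (W : WeierstrassCurve ℚ) [W.IsElliptic] [W.IsGloballyMinimal],
      W.analyticRank = 1 → ClassX3 W 3 → Additive.SubGordTwo W 3 → Upper.TwistUnitFieldOffSliverAt W 3 → MissingPPartAt W 3 :=
  fun W _ _ hr hX hG hTU =>
    missingPPartAt_of_lower_of_upper W 3
      (missingLowerBoundAt_gordTwo_three hF hA hL hCHσ hDVD hAN3 hAN hBR h212 hprop125 hfact hlift hlocal hRH hPWL h331 h411 hFE hO1 h263 h41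
        h32 W hr hX hG)
      (missingUpperBoundAt_gordTwo_three_of_printedFacts_of_twistUnitAt_of_hsieh_of_lzz_of_KY_dvd_of_prop14_of_RH_of_PWL_of_castellaHsieh_signed
        hF hA hL hDVD hfact hCHσ hRH hPWL W hr hX hG hTU)

/-- **Miller's `BSD(E, 3)` per pair on the WHOLE (G-ord, `e = 2`) cell from the TU datum** — the previous theorem through `bsdp_of_missingPPartAt` (rank =
analytic rank and `Ш` finite by GZK, conjunct 3 of `PrintedFacts`).  NOT a proof of BSD for any curve: at each of the 2 411 (G-ord) census pairs at `p = 3`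
it is BSD₃ MODULO {published theorems} ∪ {[DIV.dvd] (preprint), the analytic counts (PUB-composed, audit pending), [RH], [PWL-θ]} ∪ {the pair's TU
certificate}. [claim: KellerYin2024PotOrd, status: under-review] [cite: Miller2011LMS, §1 and Def. 1.1]
[cite: KellerYin2024b, Thm. 3.3.6 and Prop. 3.4.4 (arXiv:2410.23241 p. 19) (preprint; hypothesis)] -/
theorem bsdp_gordTwo_three_of_twistUnitAt (hF : PrintedFacts)
    (hA : Hsieh2014.thmA_exists_isHsiehLFunction_unrPeriod_anyLevel)
    (hL : LiuZhangZhang2018.thm151_thm153_modularCurve_heegnerVector_additive)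
    (hCHσ : castellaHsieh2018_exists_isBranchBDPLFunction_signed)
    (hDVD : thm336_dvd_branch_OPEN) (hAN3 : thm351_anacong_branch_three) (hAN : thm351_anacong_branch_three_allTwists)
    (hBR : thm122_charLambda_pair_three) (h212 : thm212_exists_isKatzLFunction)
    (hprop125 : prop125_characterGrSelmerDual_torsion_muZero_dim) (hfact : prop14_residualCharacterSelmer_finite)
    (hlift : cor126_residualCharacter_globalLift) (hlocal : cor126_residualCharacter_localSurjective)
    (hRH : thm122_rubinHida_residualPair_unrSelmer) (hPWL : prop125_residualPair_unrSelmer_imprimitive)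
    (h331 : thm331_rubin_exists_katzMeasure₂_pseudoIso_span_eq) (h411 : prop411_selmer_isAlmostDivisible)
    (hFE : thmII64_katzMeasure₂_functionalEquation) (hO1 : thmI_mu_katzBranch_reflect_eq_zero)
    (h263 : prop263_sur_of_crk) (h41 : prop41_globalEulerPoincareCorank) (h32 : prop32_cohomology_isCofinitelyGenerated) :
    ∀ (W : WeierstrassCurve ℚ) [W.IsElliptic] [W.IsGloballyMinimal],
      W.analyticRank = 1 → ClassX3 W 3 → Additive.SubGordTwo W 3 → Upper.TwistUnitFieldOffSliverAt W 3 → BSDp W 3 :=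
  fun W _ _ hr hX hG hTU =>
    bsdp_of_missingPPartAt W 3 hF.2.2.1 (le_of_eq hr)
      (missingPPartAt_gordTwo_three_of_twistUnitAt hF hA hL hCHσ hDVD hAN3 hAN hBR h212 hprop125 hfact hlift hlocal hRH hPWL h331 h411 hFE hO1
        h263 h41 h32 W hr hX hG hTU)

end Summit.BirchSwinnertonDyer.BirchSwinnertonDyer.Theorems.SchneiderFreeAdditiveX3.KYBranchThreeAnomalousClass

end
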